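import Literature.AlgebraicGeometry.Frobenioids.FrobeniusConjugates
import HarnessLib

/-!
# Frobenioids I, Definition 3.1 (ii)/(iii), preliminaries: chosen Frobenius powers `A^{(d)}`,
# their transition morphisms, and the Prop. 1.10 (i) transport between levels

Mochizuki, *The geometry of Frobenioids I: the general theory*, Kyushu J. Math. **62** (2008)
293–400, Definition 1.3 (ii) (p. 24), Proposition 1.10 (i) (p. 34) and Definition 3.1 (ii)(iii)
(pp. 56–57) [cite: MochizukiFrdI2008, Def. 3.1 (ii) p.56].  Standing data: a Frobenioid `C → F_Φ`
(found's functor `F : C ⥤ ElemFrobenioid Φ` with `hF : IsFrobenioid F`).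

The perfection `C^pf` (Def. 3.1 (iii)) has objects the pairs `(A, n)` and morphisms the *perfected
morphisms* `Hom^pf_C(A′, B′) = lim_→ Hom_C(A″, B″)` (Def. 3.1 (ii)), the inductive limit running over
pairs of morphisms of Frobenius type of the same degree with the transition maps "`φ ↦ φ′`" of
Prop. 1.10 (i).  This file fixes the bookkeeping that makes the limit concrete (file
`Perfection.lean` builds the category):

* `frobPow hF A d`, `frob hF A d : A ⟶ frobPow hF A d` — a CHOSEN morphism of Frobenius type of
  Frobenius degree `d` out of `A` (it exists by Def. 1.3 (ii) = `IsFrobenioid.ii_exists`; any two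
  choices differ by a unique isomorphism, Def. 1.3 (ii) = `ii_unique`, so nothing depends on the
  choice up to canonical isomorphism);
* `frobTrans hF A h : frobPow hF A d ⟶ frobPow hF A d'` for `d ∣ d'` — the unique arrow under `A`,
  of Frobenius type of degree `d'/d`; these are functorial in the divisibility order (`frobTrans_rfl`,
  `frobTrans_trans`);
* `conjFr hF φ hα hβ hd` — the Prop. 1.10 (i) conjugate `φ′` of `φ` along Frobenius-type `α`, `β` of the
  same degree (t1's `existsUnique_frobeniusConjugate` turned into a function), and `liftLevel` — its
  instance along two transition morphisms, with functoriality in the level (`liftLevel_trans`) and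
  compatibility with composition (`liftLevel_comp`).
Multiplicative conventions as in the rest of the directory. Nothing here is specific to abc.
-/

namespace Literature.AlgebraicGeometry.Frobenioids

namespace PreFrobenioid

open CategoryTheory Opposite

universe w v v' u u'

variable {D : Type u} [Category.{v} D] {Φ : Dᵒᵖ ⥤ CommMonCat.{w}}
  {C : Type u'} [Category.{v'} C] {F : C ⥤ ElemFrobenioid Φ} (hF : IsFrobenioid F)

/-! ### Chosen Frobenius powers (Def. 1.3 (ii)) -/

/-- `A^{(d)}`: the codomain of a chosen morphism of Frobenius type of degree `d` out of `A`
(Def. 1.3 (ii): "for every `A ∈ Ob(C)`, `n ∈ N_{≥1}`, there exists a morphism of Frobenius type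
`φ : A → B` of Frobenius degree `n`"). [cite: MochizukiFrdI2008, Def. 1.3 (ii) p.24] -/
noncomputable def frobPow (A : C) (d : ℕ+) : C := (hF.ii_exists A d).choose

/-- The chosen morphism of Frobenius type `A → A^{(d)}` of Frobenius degree `d` (Def. 1.3 (ii)).
[cite: MochizukiFrdI2008, Def. 1.3 (ii) p.24] -/
noncomputable def frob (A : C) (d : ℕ+) : A ⟶ frobPow hF A d :=
  (hF.ii_exists A d).choose_spec.choose

/-- `frob` is of Frobenius type. [cite: MochizukiFrdI2008, Def. 1.3 (ii) p.24] -/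
theorem isFrobeniusType_frob (A : C) (d : ℕ+) : IsFrobeniusType F (frob hF A d) :=
  (hF.ii_exists A d).choose_spec.choose_spec.1

/-- `frob` has Frobenius degree `d`. [cite: MochizukiFrdI2008, Def. 1.3 (ii) p.24] -/
@[simp] theorem degFr_frob (A : C) (d : ℕ+) : degFr F (frob hF A d) = d :=
  (hF.ii_exists A d).choose_spec.choose_spec.2

/-- `frob` is an epimorphism (`C` is totally epimorphic). [cite: MochizukiFrdI2008, Def. 1.3 (ii) p.24] -/
theorem epi_frob (A : C) (d : ℕ+) : Epi (frob hF A d) :=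
  hF.isPreFrobenioid.isTotallyEpimorphic.epi _

/-! ### The Prop. 1.10 (i) conjugate as a function -/

/-- The Prop. 1.10 (i) conjugate `φ′ : A′ → B′` of `φ : A → B` along morphisms of Frobenius type
`α : A → A′`, `β : B → B′` of the same degree: the unique arrow with `φ′ ∘ α = β ∘ φ`.
[cite: MochizukiFrdI2008, Prop. 1.10 (i) p.34] -/
noncomputable def conjFr {A B A' B' : C} (φ : A ⟶ B) {α : A ⟶ A'} {β : B ⟶ B'}
    (hα : IsFrobeniusType F α) (hβ : IsFrobeniusType F β) (hd : degFr F α = degFr F β) : A' ⟶ B' :=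
  (existsUnique_frobeniusConjugate hF φ hα hβ hd).exists.choose

/-- The defining square of the conjugate: `α ≫ φ′ = φ ≫ β`. [cite: MochizukiFrdI2008, Prop. 1.10 (i) p.34] -/
theorem conjFr_spec {A B A' B' : C} (φ : A ⟶ B) {α : A ⟶ A'} {β : B ⟶ B'}
    (hα : IsFrobeniusType F α) (hβ : IsFrobeniusType F β) (hd : degFr F α = degFr F β) :
    α ≫ conjFr hF φ hα hβ hd = φ ≫ β :=
  (existsUnique_frobeniusConjugate hF φ hα hβ hd).exists.choose_spec

/-- Uniqueness of the conjugate. [cite: MochizukiFrdI2008, Prop. 1.10 (i) p.34] -/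
theorem conjFr_unique {A B A' B' : C} {φ : A ⟶ B} {α : A ⟶ A'} {β : B ⟶ B'}
    (hα : IsFrobeniusType F α) (hβ : IsFrobeniusType F β) (hd : degFr F α = degFr F β)
    {ψ : A' ⟶ B'} (h : α ≫ ψ = φ ≫ β) : ψ = conjFr hF φ hα hβ hd :=
  (existsUnique_frobeniusConjugate hF φ hα hβ hd).unique h (conjFr_spec hF φ hα hβ hd)

/-! ### Transition morphisms between Frobenius powers -/

/-- For `d ∣ d'` there is a morphism of Frobenius type `A^{(d)} → A^{(d')}` under `A` (compose a
Frobenius-type arrow of degree `d'/d` out of `A^{(d)}` with the isomorphism provided by the essential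
uniqueness of Def. 1.3 (ii)). [cite: MochizukiFrdI2008, Def. 1.3 (ii) p.24] -/
theorem exists_frobTrans (A : C) {d d' : ℕ+} (h : d ∣ d') :
    ∃ θ : frobPow hF A d ⟶ frobPow hF A d', IsFrobeniusType F θ ∧ frob hF A d ≫ θ = frob hF A d' := by
  obtain ⟨e, rfl⟩ := h
  have h1 : IsFrobeniusType F (frob hF A d ≫ frob hF (frobPow hF A d) e) :=
    IsFrobeniusType.comp F hF (isFrobeniusType_frob hF A d) (isFrobeniusType_frob hF _ e)
  obtain ⟨i, hi⟩ := hF.ii_unique (frob hF A d ≫ frob hF (frobPow hF A d) e) (frob hF A (d * e)) h1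
    (isFrobeniusType_frob hF A (d * e)) (by rw [degFr_comp, degFr_frob, degFr_frob, degFr_frob])
  exact ⟨frob hF (frobPow hF A d) e ≫ i.hom,
    IsFrobeniusType.comp F hF (isFrobeniusType_frob hF _ e)
      (isFrobeniusType_of_isIso F hF.isPreFrobenioid i.hom),
    by rw [← Category.assoc, hi]⟩

/-- `frobTrans hF A h : A^{(d)} → A^{(d')}` for `h : d ∣ d'`: the (unique) arrow under `A` between the
chosen Frobenius powers. [cite: MochizukiFrdI2008, Def. 3.1 (ii) p.56] -/
noncomputable def frobTrans (A : C) {d d' : ℕ+} (h : d ∣ d') : frobPow hF A d ⟶ frobPow hF A d' :=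
  (exists_frobTrans hF A h).choose

/-- `frobTrans` is of Frobenius type. [cite: MochizukiFrdI2008, Def. 3.1 (ii) p.56] -/
theorem isFrobeniusType_frobTrans (A : C) {d d' : ℕ+} (h : d ∣ d') :
    IsFrobeniusType F (frobTrans hF A h) :=
  (exists_frobTrans hF A h).choose_spec.1

/-- `frobTrans` lies under `A`: `frob_d ≫ frobTrans = frob_{d'}`. [cite: MochizukiFrdI2008, Def. 3.1 (ii) p.56] -/
theorem frob_frobTrans (A : C) {d d' : ℕ+} (h : d ∣ d') :
    frob hF A d ≫ frobTrans hF A h = frob hF A d' :=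
  (exists_frobTrans hF A h).choose_spec.2

/-- Uniqueness of `frobTrans` among arrows under `A` (`frob` is an epimorphism).
[cite: MochizukiFrdI2008, Def. 3.1 (ii) p.56] -/
theorem frobTrans_unique (A : C) {d d' : ℕ+} (h : d ∣ d') {θ : frobPow hF A d ⟶ frobPow hF A d'}
    (hθ : frob hF A d ≫ θ = frob hF A d') : θ = frobTrans hF A h := by
  haveI := epi_frob hF A d
  exact (cancel_epi (frob hF A d)).mp (hθ.trans (frob_frobTrans hF A h).symm)

/-- Degrees: `d · deg_Fr(frobTrans) = d'`. [cite: MochizukiFrdI2008, Def. 3.1 (ii) p.56] -/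
theorem degFr_frobTrans (A : C) {d d' : ℕ+} (h : d ∣ d') :
    d * degFr F (frobTrans hF A h) = d' := by
  have := congrArg (degFr F) (frob_frobTrans hF A h)
  rwa [degFr_comp, degFr_frob, degFr_frob] at this

/-- `frobTrans` along `d ∣ d` is the identity. [cite: MochizukiFrdI2008, Def. 3.1 (ii) p.56] -/
@[simp] theorem frobTrans_rfl (A : C) {d : ℕ+} (h : d ∣ d) : frobTrans hF A h = 𝟙 _ :=
  (frobTrans_unique hF A h (Category.comp_id _)).symm

/-- Functoriality of the transitions: `frobTrans_{d ∣ d'} ≫ frobTrans_{d' ∣ d''} = frobTrans_{d ∣ d''}`.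
[cite: MochizukiFrdI2008, Def. 3.1 (ii) p.56] -/
theorem frobTrans_trans (A : C) {d d' d'' : ℕ+} (h₁ : d ∣ d') (h₂ : d' ∣ d'') :
    frobTrans hF A h₁ ≫ frobTrans hF A h₂ = frobTrans hF A (h₁.trans h₂) :=
  frobTrans_unique hF A _ (by rw [← Category.assoc, frob_frobTrans, frob_frobTrans])

/-! ### Levels and the transport of representatives (the transition maps of `Hom^pf`) -/

/-- Transition morphisms at two ends of a level have the same Frobenius degree: if `n·a = m·b` and
`n·a' = m·b'` with `a ∣ a'`, `b ∣ b'`, then `deg_Fr(A^{(a)} → A^{(a')}) = deg_Fr(B^{(b)} → B^{(b')})`.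
[cite: MochizukiFrdI2008, Def. 3.1 (iii) p.57] -/
theorem degFr_frobTrans_eq (A B : C) {n m a b a' b' : ℕ+} (hab : n * a = m * b)
    (hab' : n * a' = m * b') (ha : a ∣ a') (hb : b ∣ b') :
    degFr F (frobTrans hF A ha) = degFr F (frobTrans hF B hb) := by
  have h₁ := degFr_frobTrans hF A ha
  have h₂ := degFr_frobTrans hF B hb
  have : n * a * degFr F (frobTrans hF A ha) = n * a * degFr F (frobTrans hF B hb) := by
    rw [mul_assoc, h₁, hab', hab, mul_assoc, h₂]
  exact mul_left_cancel this

/-- Transport of a representative `φ : A^{(a)} → B^{(b)}` to the level `(a', b')` (`a ∣ a'`, `b ∣ b'`,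
transitions of equal degree): its Prop. 1.10 (i) conjugate along the two transition morphisms — the
transition map of the inductive system defining `Hom^pf`. [cite: MochizukiFrdI2008, Def. 3.1 (ii) p.56] -/
noncomputable def liftLevel {A B : C} {a b a' b' : ℕ+} (φ : frobPow hF A a ⟶ frobPow hF B b)
    (ha : a ∣ a') (hb : b ∣ b') (hd : degFr F (frobTrans hF A ha) = degFr F (frobTrans hF B hb)) :
    frobPow hF A a' ⟶ frobPow hF B b' :=
  conjFr hF φ (isFrobeniusType_frobTrans hF A ha) (isFrobeniusType_frobTrans hF B hb) hd

/-- The defining square of `liftLevel`. [cite: MochizukiFrdI2008, Def. 3.1 (ii) p.56] -/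
theorem liftLevel_spec {A B : C} {a b a' b' : ℕ+} (φ : frobPow hF A a ⟶ frobPow hF B b)
    (ha : a ∣ a') (hb : b ∣ b') (hd : degFr F (frobTrans hF A ha) = degFr F (frobTrans hF B hb)) :
    frobTrans hF A ha ≫ liftLevel hF φ ha hb hd = φ ≫ frobTrans hF B hb :=
  conjFr_spec hF φ _ _ hd

/-- Uniqueness of `liftLevel`. [cite: MochizukiFrdI2008, Def. 3.1 (ii) p.56] -/
theorem liftLevel_unique {A B : C} {a b a' b' : ℕ+} {φ : frobPow hF A a ⟶ frobPow hF B b}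
    (ha : a ∣ a') (hb : b ∣ b') (hd : degFr F (frobTrans hF A ha) = degFr F (frobTrans hF B hb))
    {ψ : frobPow hF A a' ⟶ frobPow hF B b'} (h : frobTrans hF A ha ≫ ψ = φ ≫ frobTrans hF B hb) :
    ψ = liftLevel hF φ ha hb hd :=
  conjFr_unique hF _ _ hd h

/-- Transport to the same level is the identity. [cite: MochizukiFrdI2008, Def. 3.1 (ii) p.56] -/
theorem liftLevel_rfl {A B : C} {a b : ℕ+} (φ : frobPow hF A a ⟶ frobPow hF B b) (ha : a ∣ a)
    (hb : b ∣ b) (hd : degFr F (frobTrans hF A ha) = degFr F (frobTrans hF B hb)) :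
    liftLevel hF φ ha hb hd = φ :=
  (liftLevel_unique hF ha hb hd (by rw [frobTrans_rfl, frobTrans_rfl, Category.id_comp,
    Category.comp_id])).symm

/-- Transport is functorial in the level. [cite: MochizukiFrdI2008, Def. 3.1 (ii) p.56] -/
theorem liftLevel_trans {A B : C} {a b a' b' a'' b'' : ℕ+} (φ : frobPow hF A a ⟶ frobPow hF B b)
    (ha : a ∣ a') (hb : b ∣ b') (hd : degFr F (frobTrans hF A ha) = degFr F (frobTrans hF B hb))
    (ha' : a' ∣ a'') (hb' : b' ∣ b'')
    (hd' : degFr F (frobTrans hF A ha') = degFr F (frobTrans hF B hb'))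
    (hd'' : degFr F (frobTrans hF A (ha.trans ha')) = degFr F (frobTrans hF B (hb.trans hb'))) :
    liftLevel hF (liftLevel hF φ ha hb hd) ha' hb' hd' = liftLevel hF φ (ha.trans ha') (hb.trans hb') hd'' := by
  apply liftLevel_unique
  rw [← frobTrans_trans hF A ha ha', ← frobTrans_trans hF B hb hb', Category.assoc, liftLevel_spec,
    ← Category.assoc, liftLevel_spec, Category.assoc]

/-- Transport is compatible with composition at a matching middle level.
[cite: MochizukiFrdI2008, Def. 3.1 (iii) p.57] -/
theorem liftLevel_comp {A B E : C} {a b c a' b' c' : ℕ+} (φ : frobPow hF A a ⟶ frobPow hF B b)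
    (ψ : frobPow hF B b ⟶ frobPow hF E c) (ha : a ∣ a') (hb : b ∣ b') (hc : c ∣ c')
    (hd₁ : degFr F (frobTrans hF A ha) = degFr F (frobTrans hF B hb))
    (hd₂ : degFr F (frobTrans hF B hb) = degFr F (frobTrans hF E hc)) :
    liftLevel hF (φ ≫ ψ) ha hc (hd₁.trans hd₂) = liftLevel hF φ ha hb hd₁ ≫ liftLevel hF ψ hb hc hd₂ :=
  (liftLevel_unique hF ha hc _ (by rw [← Category.assoc, liftLevel_spec, Category.assoc,
    liftLevel_spec, Category.assoc])).symm

/-- Transport of an identity is an identity. [cite: MochizukiFrdI2008, Def. 3.1 (iii) p.57] -/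
theorem liftLevel_id {A : C} {a a' : ℕ+} (ha : a ∣ a')
    (hd : degFr F (frobTrans hF A ha) = degFr F (frobTrans hF A ha)) :
    liftLevel hF (𝟙 (frobPow hF A a)) ha ha hd = 𝟙 _ :=
  (liftLevel_unique hF ha ha hd (by rw [Category.id_comp, Category.comp_id])).symm

end PreFrobenioid

end Literature.AlgebraicGeometry.Frobenioids
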